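import Summits.BirchSwinnertonDyer.Rank1Residual.X2.NonPrimitiveLambdaShift
import Summits.BirchSwinnertonDyer.Rank1Residual.X2.CyclotomicDecompositionCount
import Summits.BirchSwinnertonDyer.Rank1Residual.X2.TateTwistUnramifiedAtTwo
import Summits.BirchSwinnertonDyer.Rank1Residual.X2.LocalInertiaCohomologyMultiplicativeVanishing
import Summits.BirchSwinnertonDyer.Rank1Residual.X2.LocalInertiaCohomologyAdditive
import Summits.BirchSwinnertonDyer.Rank1Residual.X2.GreenbergVatsalTateFrobeniusSign
import Summits.BirchSwinnertonDyer.Rank1Residual.Iwasawa.InertiaCohomologyPTorsionFinite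
import Literature.NumberTheory.EllipticCurves.RootNumberTwistProofs
import Literature.NumberTheory.EllipticCurves.PAdicBSDSplitMultiplicativeProofs
import HarnessLib

/-!
# The `λ`-shift of the non-primitive datum Selmer group OVER `ℚ`, UPPER HALF, from published inputs
# only: `λ(X^{Σ₀}) ≤ λ(X) + Σ_{ℓ∈Σ₀} δ_E^{(ℓ)}` for `Σ₀` a set of BAD primes `≠ p` (Greenberg–Vatsal
# 2000 Cor. (2.3) conclusion 4 with Prop. (2.4), the `≤` direction) — cell `b2b-bsdres`, unit
# `b2b-bsdres-eisenstein-p2`, gen 30, programme P1 (X2-GAP §34)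

HONEST FRAMING (run/shared/lean/b2b/bsd-rank1-residual/, verbatim in every file): the goal of the
cell is to DELETE the COMBINATION-SHAPED residual classes of the Birch–Swinnerton-Dyer formula for
ALL analytic-rank `≤ 1` elliptic curves over `ℚ` — "full BSD formula for every rank `≤ 1` curve in
class `C`" assembled STRICTLY from published theorems — so that the rank-`≤ 1` remainder becomes
exactly the CONSTRUCTION-SHAPED classes, which are TYPED (missing-input `Prop`s), NOT attempted.
This is not "finishing BSD". Research route; NO CLAIM BEYOND STATED CLASSES; nothing here changes a
label. Theorems only; no definition, no named fact, no `sorry`. CONDITIONAL only on the tree's named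
facts `Silverman1994_thmV53_tateUniformisation` / `Silverman1994_thmV53_corV54_tateUniformisation`
(Silverman *ATAEC* V.3.1, V.5.2–5.4, PUBLISHED; hypotheses `hT`, `hT'` — already binders A40/A41 of
every X2 closing form).

WHAT. `E/ℚ` globally minimal, `p` an ODD prime, `κ` the cyclotomic `ℤ_p`-extension with topological
generator `γ`, `L` ANY Greenberg data for `A = E[p^∞]`, `S₀` a finite set of places `v ∤ p` of BAD
(additive or multiplicative) reduction.

* §1 **`zpCorank_le_dMultiplicity`** — at a bad `v ∤ p`, every subgroup `Y` of the image of
  `r_v : H¹(ℚ_∞, A) → H¹(I_η, A)` has `corank_{ℤ_p} Y ≤ d_v` (`GreenbergVatsal2000.dMultiplicity`):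
  additive `v`: `H¹(I_η, A)` is finite (gen 29 `LocalInertiaCohomologyAdditive`), `d_v = 0`;
  multiplicative `v`: `#H¹(I_η, A)[p] ≤ p` (gen 30 `LocalInertiaCohomologyMultiplicative`, Tate data
  from `hT`/`hT'`, the unramifiedness `ht` by gen 9's `inertia_fix_sqrt_gamma` at odd `ℓ` and
  `TateTwistUnramifiedAtTwo` at `ℓ = 2`), and when `d_v = 0`, i.e. `ℓ ≢ a_ℓ (mod p)`
  (`LocalDeltaCalculus`), the image of `r_v` has no `p`-torsion
  (`LocalInertiaCohomologyMultiplicativeVanishing`, sign of Frobenius on `√γ` from gen 12's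
  `frob_apply_sqrt_gamma_ne` at odd non-split `ℓ`, vacuous at `ℓ = 2`).
* §2 **`lambdaInvariant_le_add_sum_delta`** — for a f.g. torsion dual datum `X` of `S_A(ℚ_∞)` and a
  dual datum `X₀` of `S^{Σ₀}_A(ℚ_∞)`: `X₀` f.g., torsion, `μ(X₀) = μ(X)`, and
  `λ(X₀) ≤ λ(X) + Σ_{v∈S₀} delta W p v` — `NonPrimitiveLambdaShift.lambdaInvariant_le_add_sum_of_local`
  with `N_v = s_ℓ` (`CyclotomicDecompositionCount.forall_exists_lt_sFactor`) and `c_v = d_v` (§1).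
  This is the UPPER HALF of conclusion 4 of the registered fact
  `GreenbergVatsal2000.datumSelmer_nonPrimitive_invariants` (T-GV23L) for BAD `Σ₀` — the only
  direction the X2 lineage consumes (X2-GAP §34.1 (b)); the lower half (GV Prop. (2.1)) is NOT claimed.

References: [GreenbergVatsal2000] §2 Cor. (2.3), Prop. (2.4), pp. 14–15, 20–23;
[SilvermanATAEC1994] V.3.1, V.5.2–5.4, Ex. 5.11; [Washington1997] §13.1; HOME X2-GAP.md §34.
-/

set_option autoImplicit false

noncomputable section

open scoped Classical AddSubgroup NNReal

open NumberField IsDedekindDomain Field ValuativeRel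
open Literature.NumberTheory.GaloisRepresentations Literature.NumberTheory.EllipticCurves
  Literature.NumberTheory.EllipticCurves.GreenbergSelmer
  Literature.NumberTheory.EllipticCurves.GreenbergVatsal2000
  Literature.NumberTheory.GaloisRepresentations.IsNonarchimedeanLocalField
  IsDedekindDomain.HeightOneSpectrum
  Summit.BirchSwinnertonDyer.Rank1Residual.Iwasawa
  Summit.BirchSwinnertonDyer.Rank1Residual.X2.GreenbergVatsalTateDatumSign

namespace Summit.BirchSwinnertonDyer.Rank1Residual.X2.NonPrimitiveLambdaShiftRat

variable (W : WeierstrassCurve ℚ) [W.IsElliptic] [W.IsGloballyMinimal] {p : ℕ} [hp : Fact p.Prime]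
  (κ : ZpExtension ℚ p) {v : HeightOneSpectrum (𝓞 ℚ)}

/-! ## §1. The per-place corank bound `c_v = d_v` at a bad place -/

omit [W.IsElliptic] [W.IsGloballyMinimal] hp in
/-- A bad place is additive or multiplicative (Mathlib's trichotomy for the local minimal model).
[cite: SilvermanAEC2009, VII.5 Prop. 5.1] -/
theorem additive_or_multiplicative_of_not_hasGoodReductionAt (hbad : ¬ W.HasGoodReductionAt v) :
    W.HasAdditiveReductionAt v ∨ W.HasMultiplicativeReductionAt v := by
  rcases WeierstrassCurve.hasGoodReduction_or_hasMultiplicativeReduction_or_hasAdditiveReduction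
    (v.adicCompletionIntegers ℚ) (W := W.localMinimalModel v) with h | h | h
  · exact absurd h hbad
  · exact Or.inr h
  · exact Or.inl h

omit [W.IsGloballyMinimal] in
/-- `p ∣ ℓ − s` with `s = 1` or `s = −1` as an `if`, read in `ZMod p`. [folklore] -/
theorem dvd_sub_ite_iff (ℓ : ℕ) (c : Prop) [Decidable c] :
    ((p : ℤ) ∣ (ℓ : ℤ) - (if c then 1 else -1)) ↔
      (if c then (ℓ : ZMod p) = 1 else (ℓ : ZMod p) = -1) := by
  split_ifs with hc
  · rw [← ZMod.intCast_zmod_eq_zero_iff_dvd]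
    push_cast
    rw [sub_eq_zero]
  · rw [← ZMod.intCast_zmod_eq_zero_iff_dvd]
    push_cast
    rw [sub_neg_eq_add, add_eq_zero_iff_eq_neg]

/-- A subgroup `Y` of a group with at most `p` elements of `p`-torsion (finite) has
`corank_{ℤ_p} Y ≤ 1`. [folklore] -/
theorem zpCorank_le_one_of_ambient {G : Type*} [AddCommGroup G] (hfin : Finite (G[(p : ℤ)]))
    (hcard : Nat.card (G[(p : ℤ)]) ≤ p) (Y : AddSubgroup G) : zpCorank Y p ≤ 1 := by
  haveI := hfin
  let j : (↥Y)[(p : ℤ)] → G[(p : ℤ)] := fun y ↦ ⟨((y : Y) : G), by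
    rw [AddSubgroup.torsionBy.nsmul_iff, ← AddSubmonoidClass.coe_nsmul,
      AddSubgroup.torsionBy.nsmul_iff.1 y.2, ZeroMemClass.coe_zero]⟩
  have hj : Function.Injective j := fun a b hab ↦ by
    have h := congrArg Subtype.val hab
    exact Subtype.ext (Subtype.ext h)
  haveI : Finite ((↥Y)[(p : ℤ)]) := Finite.of_injective j hj
  exact NonPrimitiveQuotientCorank.zpCorank_le_one_of_natCard_torsionBy_le
    ((Nat.card_le_card_of_injective j hj).trans hcard)

/-- **At a BAD place `v ∤ p` every subgroup `Y` of the image of `r_v : H¹(ℚ_∞, E[p^∞]) → H¹(I_η, E[p^∞])`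
has `corank_{ℤ_p} Y ≤ d_v`** (`E/ℚ` globally minimal, `p` odd, any `ℤ_p`-extension `κ` for the
bound itself; the Tate uniformisations `hT`, `hT'` at multiplicative `v`). Additive `v`: `H¹(I_η, A)` is
finite and `d_v = 0`. Multiplicative `v`: `#H¹(I_η, A)[p] ≤ p` gives `≤ 1`; and if `d_v = 0` — split:
`ℓ ≢ 1`, non-split: `ℓ ≢ −1 (mod p)` — the image of `r_v` has no `p`-torsion because `p ∤ ℓ − χ(φ)`
for the sign `χ(φ)` of a Frobenius on `√γ` (`+1` split with the untwisted parametrisation; `−1` at an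
odd non-split `ℓ` by `frob_apply_sqrt_gamma_ne`; either sign at `ℓ = 2`, where `ℓ ± 1 ∈ {1, 3}`).
GV Prop. (2.4): `corank 𝓗_ℓ(ℚ_∞) = s_ℓ d_ℓ`, per place `η` the factor `d_ℓ`.
[cite: GreenbergVatsal2000, §2 Prop. (2.4) pp. 22–23 and pp. 14–15]
[cite: SilvermanATAEC1994, Ch. V Lemma 5.2 (c), Thm. 5.3 (a),(b), Cor. 5.4 (held copy PDF pp. 406–410)] -/
theorem zpCorank_le_dMultiplicity (hT : Silverman1994_thmV53_tateUniformisation.{0})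
    (hT' : Silverman1994_thmV53_corV54_tateUniformisation.{0}) (hp2 : p ≠ 2)
    (hpv : ((p : ℕ) : 𝓞 ℚ) ∉ v.asIdeal)
    (hbad : W.HasAdditiveReductionAt v ∨ W.HasMultiplicativeReductionAt v)
    (Y : AddSubgroup (discreteH1 (inertiaIn κ.kerSubgroup v) (W.geomPrimaryTorsion p)))
    (hY : ∀ y ∈ Y, ∃ c : subgroupH1 κ.kerSubgroup (W.geomPrimaryTorsion p),
      resH1Hom (inertiaInToH κ.kerSubgroup v) (AddMonoidHom.id (W.geomPrimaryTorsion p))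
        (fun _ _ ↦ rfl) c = y) :
    zpCorank Y p ≤ dMultiplicity W p v := by
  have hIH : inertia (K := ℚ) v ≤ κ.kerSubgroup := inertia_le_kerSubgroup' κ v hpv
  set ℓ := Rat.HeightOneSpectrum.natGenerator v with hℓ
  have hℓprime : ℓ.Prime := Rat.HeightOneSpectrum.prime_natGenerator v
  haveI hℓfact : Fact ℓ.Prime := ⟨hℓprime⟩
  have hℓv : ((ℓ : ℕ) : 𝓞 ℚ) ∈ v.asIdeal := Rat.HeightOneSpectrum.natCast_natGenerator_mem v
  have hqℓ : residueFieldCard (v.adicCompletion ℚ) = ℓ :=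
    CyclotomicDecompositionCount.residueFieldCard_eq_natGenerator
  rcases hbad with hadd | hmult
  · -- additive: the local group is finite
    haveI := LocalInertiaCohomologyAdditive.finite_discreteH1_inertiaIn_of_hasAdditiveReductionAt W p
      κ.kerSubgroup v hpv hadd hIH
    haveI : Finite Y := inferInstance
    rw [zpCorank_of_finite_eq_zero]
    exact Nat.zero_le _
  · -- multiplicative: Tate data (untwisted if split, twisted otherwise)
    have hmultℓ : W.HasMultiplicativeReductionAtPrime ℓ :=
      (W.hasMultiplicativeReductionAtPrime_iff_hasMultiplicativeReductionAt_ringOfIntegers v).2 hmult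
    -- a Frobenius of `ℚ_v`
    obtain ⟨φ, hφ⟩ := exists_isFrobPow_holds (F := v.adicCompletion ℚ) 1
    by_cases hsplit : W.HasSplitMultiplicativeReductionAt v
    · obtain ⟨q, Φ, hq0, hq1, hsurj, hker, hΦσ, -⟩ := hT W v hsplit
      have hker' : ∀ u : (AlgebraicClosure (v.adicCompletion ℚ))ˣ, Φ (Additive.ofMul u) = 0 →
          ∃ a : ℤ, (u : AlgebraicClosure (v.adicCompletion ℚ)) =
            algebraMap (v.adicCompletion ℚ) (AlgebraicClosure (v.adicCompletion ℚ)) q ^ a :=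
        fun u h ↦ (hker u).1 h
      have hΨσ := sign_of_equivariant W Φ hΦσ
      have ht : ∀ σ ∈ absInertia (v.adicCompletion ℚ),
          Field.absoluteGaloisGroup.toAlgEquiv (v.adicCompletion ℚ) σ
            (0 : AlgebraicClosure (v.adicCompletion ℚ)) = 0 := fun σ _ ↦ map_zero _
      have ht2 : (0 : AlgebraicClosure (v.adicCompletion ℚ)) ^ 2 =
          algebraMap (v.adicCompletion ℚ) (AlgebraicClosure (v.adicCompletion ℚ)) 0 := by
        rw [map_zero, zero_pow two_ne_zero]
      obtain ⟨hfin, hcard⟩ :=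
        LocalInertiaCohomologyMultiplicative.natCard_torsionBy_discreteH1_inertiaIn_le W p Φ 0 hΨσ hsurj
          hq0 hq1 hker' ht hpv κ.kerSubgroup hmult hIH
      rw [LocalDeltaCalculus.dMultiplicity_of_hasSplitMultiplicativeReductionAt hsplit]
      split_ifs with hd
      · exact zpCorank_le_one_of_ambient hfin hcard Y
      · -- `ℓ ≢ 1`: no `p`-torsion in the image of `r_v`
        rw [NonPrimitiveQuotientCorank.zpCorank_eq_zero_of_torsionBy_trivial]
        rintro ⟨y, hy⟩ hpy
        obtain ⟨c, rfl⟩ := hY y hy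
        have hpc : p • resH1Hom (inertiaInToH κ.kerSubgroup v) (AddMonoidHom.id (W.geomPrimaryTorsion p))
            (fun _ _ ↦ rfl) c = 0 := congrArg Subtype.val hpy
        apply Subtype.ext
        refine LocalInertiaCohomologyMultiplicative.resH1Hom_inertiaIn_eq_zero_of_prime_nsmul_eq_zero_kerSubgroup
          W p Φ 0 hΨσ hsurj hq0 hq1 hker' ht hpv κ hp2 hmult hIH ht2 hφ ?_ c hpc
        rw [hqℓ, dvd_sub_ite_iff, if_pos (map_zero _)]
        exact hd
    · obtain ⟨q, t, Ψ, hq0, hq1, ht0, ht2, hsurj, hker, hΨσ, -⟩ := hT' W v hmult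
      have hker' : ∀ u : (AlgebraicClosure (v.adicCompletion ℚ))ˣ, Ψ (Additive.ofMul u) = 0 →
          ∃ a : ℤ, (u : AlgebraicClosure (v.adicCompletion ℚ)) =
            algebraMap (v.adicCompletion ℚ) (AlgebraicClosure (v.adicCompletion ℚ)) q ^ a :=
        fun u h ↦ (hker u).1 h
      have hnsℓ : ¬ W.HasSplitMultiplicativeReductionAtPrime ℓ := fun h ↦
        hsplit ((W.hasSplitMultiplicativeReductionAtPrime_iff_hasSplitMultiplicativeReductionAt v).1 h)
      -- the inertia group fixes `t` (`ℓ` odd: gen 9; `ℓ = 2`: `TateTwistUnramifiedAtTwo`)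
      have ht : ∀ σ ∈ absInertia (v.adicCompletion ℚ),
          Field.absoluteGaloisGroup.toAlgEquiv (v.adicCompletion ℚ) σ t = t := by
        by_cases hℓ2 : ℓ = 2
        · have hmult2 : W.HasMultiplicativeReductionAtPrime 2 := by
            haveI : Fact (Nat.Prime 2) := ⟨Nat.prime_two⟩
            have h := hmultℓ
            -- transport along `ℓ = 2`
            revert h
            have : ∀ (n : ℕ) (hn : Fact n.Prime), n = 2 → @WeierstrassCurve.HasMultiplicativeReductionAtPrime W n hn →
                W.HasMultiplicativeReductionAtPrime 2 := by
              rintro n hn rfl h; exact h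
            exact this ℓ hℓfact hℓ2
          have h2v : ((2 : ℕ) : 𝓞 ℚ) ∈ v.asIdeal := by rw [← hℓ2]; exact hℓv
          exact TateTwistUnramifiedAtTwo.inertia_fix_sqrt_gamma_two W hmult2 h2v t ht2
        · exact GreenbergVatsalTateDatumRat.inertia_fix_sqrt_gamma W (p := ℓ) hℓ2 hmultℓ hℓv t ht2
      obtain ⟨hfin, hcard⟩ :=
        LocalInertiaCohomologyMultiplicative.natCard_torsionBy_discreteH1_inertiaIn_le W p Ψ t hΨσ hsurj
          hq0 hq1 hker' ht hpv κ.kerSubgroup hmult hIH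
      rw [LocalDeltaCalculus.dMultiplicity_of_hasNonsplitMultiplicativeReductionAt hmult hsplit]
      split_ifs with hd
      · exact zpCorank_le_one_of_ambient hfin hcard Y
      · -- `ℓ ≢ -1`: no `p`-torsion in the image of `r_v`
        rw [NonPrimitiveQuotientCorank.zpCorank_eq_zero_of_torsionBy_trivial]
        rintro ⟨y, hy⟩ hpy
        obtain ⟨c, rfl⟩ := hY y hy
        have hpc : p • resH1Hom (inertiaInToH κ.kerSubgroup v) (AddMonoidHom.id (W.geomPrimaryTorsion p))
            (fun _ _ ↦ rfl) c = 0 := congrArg Subtype.val hpy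
        apply Subtype.ext
        refine LocalInertiaCohomologyMultiplicative.resH1Hom_inertiaIn_eq_zero_of_prime_nsmul_eq_zero_kerSubgroup
          W p Ψ t hΨσ hsurj hq0 hq1 hker' ht hpv κ hp2 hmult hIH ht2 hφ ?_ c hpc
        rw [hqℓ, dvd_sub_ite_iff]
        by_cases hℓ2 : ℓ = 2
        · -- `ℓ = 2`: `p ∤ 2 - 1` and `p ∣ 2 + 1` forces `p = 3`, i.e. `2 ≡ -1`, excluded by `hd`
          split_ifs with hsgn
          · intro h1
            rw [hℓ2] at h1
            have h1' : ((2 : ℕ) : ZMod p) - 1 = 0 := sub_eq_zero.2 h1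
            have h1'' : ((1 : ℕ) : ZMod p) = 0 := by
              rw [Nat.cast_one]; have : ((2 : ℕ) : ZMod p) = 1 + 1 := by norm_num
              rw [this, add_sub_cancel_right] at h1'; exact h1'
            rw [ZMod.natCast_eq_zero_iff] at h1''
            exact hp.out.one_lt.ne' (Nat.dvd_one.mp h1'')
          · exact hd
        · -- `ℓ` odd: the Frobenius flips `t`
          obtain ⟨𝔐, h𝔐⟩ := v.localPrimesAbove_nonempty
          have hτ := CyclotomicDecompositionCount.isArithFrobAt_of_isFrobPow_one hφ h𝔐
          have hne := GreenbergVatsalTateFrobeniusSign.frob_apply_sqrt_gamma_ne W (p := ℓ) hℓ2 hmultℓ hnsℓ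
            hℓv h𝔐 hτ t ht0 ht2
          rw [if_neg hne]
          exact hd

/-! ## §2. `λ(X₀) ≤ λ(X) + Σ_{v∈S₀} δ_E^{(v)}` for bad `S₀` -/

/-- **Greenberg–Vatsal Cor. (2.3), conclusion 4, UPPER HALF, over `ℚ`, from published inputs**:
for the globally minimal `E/ℚ`, an odd prime `p`, the cyclotomic `ℤ_p`-extension `κ` with
topological generator `γ`, ANY Greenberg data `L` for `A = E[p^∞]`, a finite set `S₀` of BAD places
`v ∤ p`, a finitely generated `Λ`-torsion dual datum `X` of `S_A(ℚ_∞)` and a dual datum `X₀` of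
`S^{Σ₀}_A(ℚ_∞)`: `X₀` is finitely generated and `Λ`-torsion, `μ(X₀) = μ(X)`, and
**`λ(X₀) ≤ λ(X) + Σ_{v∈S₀} δ_E^{(v)}`** (`delta W p v = s_ℓ d_ℓ`). Granted only the Tate
uniformisations A40/A41 (`hT`, `hT'`). Assembly: `lambdaInvariant_le_add_sum_of_local` with
`N_v = s_ℓ` (`forall_exists_lt_sFactor`) and `c_v = d_v` (§1). The LOWER half (equality; GV
Prop. (2.1)) is the part of the registered fact `datumSelmer_nonPrimitive_invariants` NOT claimed here.
[cite: GreenbergVatsal2000, §2 Cor. (2.3), Prop. (2.4) (arXiv:math/9906215 pp. 20–23)]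
[cite: SilvermanATAEC1994, Ch. V Lemma 5.2 (c), Thm. 5.3 (a),(b), Cor. 5.4 (held copy PDF pp. 406–410)] -/
theorem lambdaInvariant_le_add_sum_delta (hT : Silverman1994_thmV53_tateUniformisation.{0})
    (hT' : Silverman1994_thmV53_corV54_tateUniformisation.{0}) (hp2 : p ≠ 2)
    (hκ : κ.IsCyclotomic) {γ : absoluteGaloisGroup ℚ} (hγ : κ.IsTopGenerator γ)
    (L : Data ℚ (W.geomPrimaryTorsion p) p) (S₀ : Finset (HeightOneSpectrum (𝓞 ℚ)))
    (hS₀ : ∀ v ∈ S₀, ((p : ℕ) : 𝓞 ℚ) ∉ v.asIdeal)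
    (hbad : ∀ v ∈ S₀, W.HasAdditiveReductionAt v ∨ W.HasMultiplicativeReductionAt v)
    (X : DatumDualData κ γ (W.geomPrimaryTorsion p) L (∅ : Set (HeightOneSpectrum (𝓞 ℚ))))
    [Module.Finite (IwasawaAlgebra p) X.X] (hX : Module.IsTorsion (IwasawaAlgebra p) X.X)
    (X₀ : DatumDualData κ γ (W.geomPrimaryTorsion p) L (↑S₀ : Set (HeightOneSpectrum (𝓞 ℚ)))) :
    Module.Finite (IwasawaAlgebra p) X₀.X ∧ Module.IsTorsion (IwasawaAlgebra p) X₀.X ∧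
      muInvariant p X₀.X = muInvariant p X.X ∧
      lambdaInvariant p X₀.X ≤ lambdaInvariant p X.X + ∑ v ∈ S₀, delta W p v := by
  have h := NonPrimitiveLambdaShift.lambdaInvariant_le_add_sum_of_local W κ L hγ S₀ hS₀
    (fun v hv hpv ↦ exists_mem_decomp_apply_ne_one_of_isCyclotomic hκ hpv)
    (fun v ↦ sFactor p (Rat.HeightOneSpectrum.natGenerator v)) (fun v ↦ dMultiplicity W p v)
    (fun v hv σ ↦ CyclotomicDecompositionCount.forall_exists_lt_sFactor κ hκ hγ hp2 (hS₀ v hv) σ)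
    (fun v hv Y hY ↦ zpCorank_le_dMultiplicity W κ hT hT' hp2 (hS₀ v hv) (hbad v hv) Y hY) X hX X₀
  simpa only [delta_eq] using h

/-- The same with `S₀` described as a set of places `v ∤ p` which are NOT of good reduction.
[cite: GreenbergVatsal2000, §2 Cor. (2.3), Prop. (2.4) (arXiv:math/9906215 pp. 20–23)] -/
theorem lambdaInvariant_le_add_sum_delta_of_not_good (hT : Silverman1994_thmV53_tateUniformisation.{0})
    (hT' : Silverman1994_thmV53_corV54_tateUniformisation.{0}) (hp2 : p ≠ 2)
    (hκ : κ.IsCyclotomic) {γ : absoluteGaloisGroup ℚ} (hγ : κ.IsTopGenerator γ)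
    (L : Data ℚ (W.geomPrimaryTorsion p) p) (S₀ : Finset (HeightOneSpectrum (𝓞 ℚ)))
    (hS₀ : ∀ v ∈ S₀, ((p : ℕ) : 𝓞 ℚ) ∉ v.asIdeal) (hbad : ∀ v ∈ S₀, ¬ W.HasGoodReductionAt v)
    (X : DatumDualData κ γ (W.geomPrimaryTorsion p) L (∅ : Set (HeightOneSpectrum (𝓞 ℚ))))
    [Module.Finite (IwasawaAlgebra p) X.X] (hX : Module.IsTorsion (IwasawaAlgebra p) X.X)
    (X₀ : DatumDualData κ γ (W.geomPrimaryTorsion p) L (↑S₀ : Set (HeightOneSpectrum (𝓞 ℚ)))) :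
    Module.Finite (IwasawaAlgebra p) X₀.X ∧ Module.IsTorsion (IwasawaAlgebra p) X₀.X ∧
      muInvariant p X₀.X = muInvariant p X.X ∧
      lambdaInvariant p X₀.X ≤ lambdaInvariant p X.X + ∑ v ∈ S₀, delta W p v :=
  lambdaInvariant_le_add_sum_delta W κ hT hT' hp2 hκ hγ L S₀ hS₀
    (fun v hv ↦ additive_or_multiplicative_of_not_hasGoodReductionAt W (hbad v hv)) X hX X₀

end Summit.BirchSwinnertonDyer.Rank1Residual.X2.NonPrimitiveLambdaShiftRat

end
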